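import Mathlib
import Literature.RingTheory.CohomologyAnnihilator.Basic
import Summits.ResolutionOfSingularities.ResolutionOfSingularities.Theses.HomologicalConductor
import Summits.ResolutionOfSingularities.ResolutionOfSingularities.Theorems.HomologicalConductorNoZenoBirthDefs
import Summits.ResolutionOfSingularities.ResolutionOfSingularities.Theorems.HomologicalConductorNoZenoIffKernel
import Summits.ResolutionOfSingularities.ResolutionOfSingularities.Theorems.HomologicalConductorPersistenceRadicalProof
import Summits.ResolutionOfSingularities.ResolutionOfSingularities.Theorems.StrictDrop.Negative.StrictDropFalseOfSelfSimilarSeed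
import HarnessLib

/-!
# `NoZenoR` (stmt-ResolutionOfSingularities-19943) versus a ZENO SEED: a self-similar singular stage
# decides the crux — `NoZenoR ↔ ¬ StrictDrop`

Route `ResolutionOfSingularities/HomologicalConductor`, crux #2 `NoZenoR`
(`PersistenceRadical → StrictDrop → ` termination of every canonical normalised `ca`-tower).
`[OURS · L0 W4.4 · lead g14]` — replaces the role of no printed item; NOT a statement of any
manuscript; AI-formalised, weaker than expert review.

The tree already has the VALUE-NON-DECREASING self-similar seed
(`Theorems/StrictDrop/Negative/StrictDropFalseOfSelfSimilarSeed.lean`: `SelfSimilarSeed → ¬ StrictDrop`,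
hence `SelfSimilarSeed → NoZenoR` vacuously, `Theorems/HomologicalConductorNoZenoVacuity.lean`).
This file isolates the weaker, sign-free hypothesis that every census object of chain W4.4 actually
tests (E-ZENO3, the toric `(σ, g)` candidates, the CDLAL-shaped loops): a **Zeno seed** — crux data
`(p, k, K, O, A)`, a `k`-automorphism `σ` of `K` preserving `O`, and a SINGULAR stage `T_s` of the
canonical tower with `T_(s+1) = σ(T_s)` — with NO condition on how `σ` moves values. Results:

* `tower_add_eq_map` — self-similarity propagates: `T_(s+n) = σⁿ(T_s)` (from the tree's
  `StrictDrop.Negative.SelfSimilar.tower_add_succ`: `ca` is intrinsic and the step is `σ`-equivariant).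
* `not_isRegularLocalRing_tower` — under a Zeno seed NO stage is regular: later stages are ring-isomorphic
  to the singular `T_s`; an earlier regular stage would freeze the tower
  (`NoZeno.Birth.tower_succ_eq_self_of_isRegularLocalRing`) and make `T_s` regular.
* `not_termination_of_zenoSeed` — hence the conclusion of `NoZenoR` (valuative termination) fails.
* `NoZenoR_false_of_zenoSeed_of_strictDrop : ZenoSeed → StrictDrop → ¬ NoZenoR` — the landing shape
  the W4.4 desk fixed for a SELF-SIMILAR verdict of E-ZENO3 (CHAIN v31 §5: «`StrictDrop → ¬ NoZenoR`,
  never bare `¬ NoZenoR`»), proved here MODULO the seed, using the tree theorem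
  `persistenceRadical_proof` for the first hypothesis of `NoZenoR`.
* `noZenoR_iff_not_strictDrop_of_zenoSeed : ZenoSeed → (NoZenoR ↔ ¬ StrictDrop)` and
  `not_strictDrop_and_noZenoR_of_zenoSeed : ZenoSeed → ¬ (StrictDrop ∧ NoZenoR)` — a single Zeno seed
  (one normalised `ca`-blow-up chart isomorphic to its own singular base, compatibly with one valuation)
  makes the deciding chain `closes hPR hD hT hG` of the route uninstantiable, whichever of the two
  cruxes it is that fails.
* `zenoSeed_of_selfSimilarSeed : SelfSimilarSeed → ZenoSeed` — the tree's seed is the special case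
  with monotone values (there `StrictDrop` is the casualty).

Whether a Zeno seed EXISTS for the cohomology annihilator is open: no instance is known; the
period-1 toric candidates of the W4.4 census are excluded arena by arena by depth/weight sieves
(KERNEL-g13 §3, KERNEL-g14). `ZenoSeed` is the one definition of this file, stated over the route's
`let`-telescope verbatim (as `SelfSimilarSeed` is), so that a certificate instantiates it literally.
-/

noncomputable section

-- single-problem summit: the doubled namespace component is forced
set_option linter.dupNamespace false

open Summit.ResolutionOfSingularities.ResolutionOfSingularities.Theses.HomologicalConductor
  (NoZenoR StrictDrop PersistenceRadical)
open Summit.ResolutionOfSingularities.ResolutionOfSingularities.Theorems (persistenceRadical_proof)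
open Summit.ResolutionOfSingularities.ResolutionOfSingularities.Theorems.StrictDrop.Negative.SelfSimilar
  (SelfSimilarSeed tower_add_succ)

namespace Summit.ResolutionOfSingularities.ResolutionOfSingularities.Theorems.NoZenoR.Zeno

open Summit.ResolutionOfSingularities.ResolutionOfSingularities.Theorems.NoZeno.Birth
  (ca loc chart nrm tower tower_zero tower_succ tower_succ_eq_self_of_isRegularLocalRing)

variable {k K : Type} [Field k] [Field K] [Algebra k K]

/-! ## 1. Self-similarity propagates and forbids regular stages -/

/-- Under `T_(s+1) = σ(T_s)` with `σ` preserving `O`: `T_(s+n) = σⁿ(T_s)`, with `σ ^ n` the power in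
the automorphism group `K ≃ₐ[k] K`. [folklore] -/
theorem tower_add_eq_map (O : ValuationSubring K) {σ : K ≃ₐ[k] K}
    (hσ : ∀ z : K, σ z ∈ O ↔ z ∈ O) (A : Subalgebra k K) (s : ℕ)
    (h1 : tower O A (s + 1) = (tower O A s).map (σ : K →ₐ[k] K)) (n : ℕ) :
    tower O A (s + n) = (tower O A s).map ((σ ^ n : K ≃ₐ[k] K) : K →ₐ[k] K) := by
  induction n with
  | zero =>
    ext x
    simp only [add_zero, pow_zero, Subalgebra.mem_map]
    constructor
    · intro hx
      exact ⟨x, hx, rfl⟩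
    · rintro ⟨y, hy, rfl⟩
      exact hy
  | succ n ih =>
    rw [show s + (n + 1) = s + n + 1 by ring, tower_add_succ O hσ A s h1 n, ih, Subalgebra.map_map,
      pow_succ']
    congr 1

/-- **Under a Zeno seed no stage of the tower is regular.** If `T_s` is singular and
`T_(s+1) = σ(T_s)` for `σ` preserving `O`, then `T_m` is singular for every `m`: for `m ≥ s` the stage
is `σ^(m-s)(T_s) ≅ T_s`; for `m ≤ s` a regular `T_m` would freeze the tower up to `s`. [this work] -/
theorem not_isRegularLocalRing_tower (O : ValuationSubring K) {σ : K ≃ₐ[k] K}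
    (hσ : ∀ z : K, σ z ∈ O ↔ z ∈ O) (A : Subalgebra k K)
    (hk : ∀ c : k, algebraMap k K c ∈ O) (hfr : IsFractionRing ↥A K)
    (hAO : A.toSubring ≤ O.toSubring) (s : ℕ) (hsing : ¬ IsRegularLocalRing ↥(tower O A s))
    (h1 : tower O A (s + 1) = (tower O A s).map (σ : K →ₐ[k] K)) (m : ℕ) :
    ¬ IsRegularLocalRing ↥(tower O A m) := by
  intro hreg
  rcases Nat.le_or_ge s m with hsm | hms
  · -- m = s + n : transport regularity back along the ring isomorphism T_s ≃ σⁿ(T_s) = T_m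
    obtain ⟨n, rfl⟩ := Nat.exists_eq_add_of_le hsm
    have hE : tower O A (s + n) = (tower O A s).map ((σ ^ n : K ≃ₐ[k] K) : K →ₐ[k] K) :=
      tower_add_eq_map O hσ A s h1 n
    let e : ↥(tower O A s) ≃+* ↥(tower O A (s + n)) :=
      (((σ ^ n).subalgebraMap (tower O A s)).trans (Subalgebra.equivOfEq _ _ hE.symm)).toRingEquiv
    haveI := hreg
    exact hsing (IsRegularLocalRing.of_ringEquiv e.symm)
  · -- m ≤ s : a regular stage freezes the tower, so T_s = T_m would be regular
    obtain ⟨j, rfl⟩ := Nat.exists_eq_add_of_le hms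
    have hfreeze : ∀ i : ℕ, tower O A (m + i) = tower O A m := by
      intro i
      induction i with
      | zero => rfl
      | succ i ih =>
        have hreg' : IsRegularLocalRing ↥(tower O A (m + i)) := by rw [ih]; exact hreg
        rw [Nat.add_succ, tower_succ_eq_self_of_isRegularLocalRing O A hk hfr hAO (m + i) hreg', ih]
    exact hsing (by rw [hfreeze j]; exact hreg)

/-! ## 2. The Zeno seed and what it decides -/

/-- **Hypothesis `ZenoSeed` — a self-similar SINGULAR stage of the canonical `ca`-tower, with no
condition on values (the sign-free form of `StrictDrop.Negative.SelfSimilar.SelfSimilarSeed`).**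
Crux data `(p, k, K, O, A)` — `k` of characteristic `p` inside the valuation ring `O` of `K`,
`A ⊆ O` finitely generated with `Frac A = K` — a `k`-automorphism `σ` of `K` preserving `O`
(`σ z ∈ O ↔ z ∈ O`), and a stage `s` of the canonical tower (the route's `let`-telescope verbatim)
which is SINGULAR and whose successor is its `σ`-translate, `T_(s+1) = σ(T_s)`. Models: a
normalised `ca`-blow-up chart of a toric germ `X_τ` that is again `≅ X_τ` via a lattice
automorphism with an interior eigen-weight (E-ZENO3 of chain W4.4; the CDLAL Nash-blow-up loop
shape). HYPOTHESIS of the negative lemmas below; NOT proved, NOT in print, no instance known —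
every period-1 toric candidate examined so far is excluded (KERNEL-g13 §3, KERNEL-g14). -/
def ZenoSeed : Prop :=
  ∃ (p : ℕ) (_ : p.Prime) (k K : Type) (_ : Field k) (_ : CharP k p) (_ : Field K) (_ : Algebra k K) (O : ValuationSubring K) (A : Subalgebra k K) (σ : K ≃ₐ[k] K), (∀ c : k, algebraMap k K c ∈ O) ∧ A.FG ∧ IsFractionRing ↥A K ∧ A.toSubring ≤ O.toSubring ∧ (∀ z : K, σ z ∈ O ↔ z ∈ O) ∧ let ca : Subalgebra k K → Set K := fun A => {x : K | ∃ hx : x ∈ A, ∃ n : ℕ, ∀ i : ℕ, n ≤ i → ∀ (M N : ModuleCat.{0} ↥A), Module.Finite ↥A M → Module.Finite ↥A N → ∀ e : CategoryTheory.Abelian.Ext.{0} M N i, (⟨x, hx⟩ : ↥A) • e = 0}; let loc : Subalgebra k K → Subalgebra k K := fun A => Algebra.adjoin k {y : K | ∃ a ∈ A, ∃ s ∈ A, s⁻¹ ∈ O ∧ y = a * s⁻¹}; let chart : Subalgebra k K → Subalgebra k K := fun A => Algebra.adjoin k ((A : Set K) ∪ {y : K | ∃ c ∈ ca A, ∃ x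 ∈ ca A, x ≠ 0 ∧ (∀ c' ∈ ca A, c' * x⁻¹ ∈ O) ∧ y = c * x⁻¹}); let nrm : Subalgebra k K → Subalgebra k K := fun B => Algebra.adjoin k {y : K | IsIntegral ↥B y}; let tower : Subalgebra k K → ℕ → Subalgebra k K := fun A m => @Nat.rec (fun _ => Subalgebra k K) (loc A) (fun _ B => loc (nrm (chart B))) m; ∃ s : ℕ, ¬ IsRegularLocalRing ↥(tower A s) ∧ tower A (s + 1) = (tower A s).map (σ : K →ₐ[k] K)

/-- The tree's value-monotone seed is a Zeno seed (forget the monotonicity clause). [folklore] -/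
theorem zenoSeed_of_selfSimilarSeed (h : SelfSimilarSeed) : ZenoSeed := by
  obtain ⟨p, hp, k, K, iF, iC, iF', iA, O, A, σ, hk, hfg, hfrac, hle, hσ, -, s, hsing, h1⟩ := h
  exact ⟨p, hp, k, K, iF, iC, iF', iA, O, A, σ, hk, hfg, hfrac, hle, hσ, s, hsing, h1⟩

/-- **A Zeno seed refutes valuative termination** (the conclusion of `NoZenoR`, verbatim): along the
seed's datum no stage of the canonical tower is regular. [this work] -/
theorem not_termination_of_zenoSeed (h : ZenoSeed) :
    ¬ (∀ p : ℕ, p.Prime → ∀ (k K : Type) [Field k] [CharP k p] [Field K] [Algebra k K] (O : ValuationSubring K) (A : Subalgebra k K), (∀ c : k, algebraMap k K c ∈ O) → A.FG → IsFractionRing ↥A K → A.toSubring ≤ O.toSubring → let ca : Subalgebra k K → Set K := fun A => {x : K | ∃ hx : x ∈ A, ∃ n : ℕ, ∀ i : ℕ, n ≤ i → ∀ (M N : ModuleCat.{0} ↥A), Module.Finite ↥A M → Module.Finite ↥A N → ∀ e : CategoryTheory.Abelian.Ext.{0} M N i, (⟨x, hx⟩ : ↥A) • e = 0}; let loc : Subalgebra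 k K → Subalgebra k K := fun A => Algebra.adjoin k {y : K | ∃ a ∈ A, ∃ s ∈ A, s⁻¹ ∈ O ∧ y = a * s⁻¹}; let chart : Subalgebra k K → Subalgebra k K := fun A => Algebra.adjoin k ((A : Set K) ∪ {y : K | ∃ c ∈ ca A, ∃ x ∈ ca A, x ≠ 0 ∧ (∀ c' ∈ ca A, c' * x⁻¹ ∈ O) ∧ y = c * x⁻¹}); let nrm : Subalgebra k K → Subalgebra k K := fun B => Algebra.adjoin k {y : K | IsIntegral ↥B y}; let tower : Subalgebra k K → ℕ → Subalgebra k K := fun A m => @Nat.rec (fun _ => Subalgebra k K) (loc A) (fun _ B => loc (nrm (chart B))) m; ∃ m : ℕ, IsRegularLocalRing ↥(tower A m)) := by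
  intro hT
  obtain ⟨p, hp, k, K, iF, iC, iF', iA, O, A, σ, hk, hfg, hfrac, hle, hσ, s, hsing, h1⟩ := h
  obtain ⟨m, hm⟩ := @hT p hp k K iF iC iF' iA O A hk hfg hfrac hle
  exact not_isRegularLocalRing_tower O hσ A hk hfrac hle s hsing h1 m hm

/-- **`ZenoSeed → StrictDrop → ¬ NoZenoR`** — the admissible refutation shape of the crux, modulo the
seed: `NoZenoR` is `PersistenceRadical → StrictDrop → termination`, `PersistenceRadical` is the tree
theorem `persistenceRadical_proof`, so under `StrictDrop` the crux asserts termination, which the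
seed forbids. [this work] -/
theorem NoZenoR_false_of_zenoSeed_of_strictDrop (h : ZenoSeed) (hD : StrictDrop) : ¬ NoZenoR :=
  fun hZ => not_termination_of_zenoSeed h (hZ persistenceRadical_proof hD)

/-- **Under a Zeno seed the crux is equivalent to the FAILURE of `StrictDrop`.** (`←` is the vacuous
direction `¬ StrictDrop → NoZenoR`.) [this work] -/
theorem noZenoR_iff_not_strictDrop_of_zenoSeed (h : ZenoSeed) : NoZenoR ↔ ¬ StrictDrop :=
  ⟨fun hZ hD => NoZenoR_false_of_zenoSeed_of_strictDrop h hD hZ, fun hD _ hD' => absurd hD' hD⟩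

/-- **A Zeno seed makes the route's deciding chain uninstantiable**: `StrictDrop` and `NoZenoR`
cannot both hold. [this work] -/
theorem not_strictDrop_and_noZenoR_of_zenoSeed (h : ZenoSeed) : ¬ (StrictDrop ∧ NoZenoR) :=
  fun ⟨hD, hZ⟩ => NoZenoR_false_of_zenoSeed_of_strictDrop h hD hZ

end Summit.ResolutionOfSingularities.ResolutionOfSingularities.Theorems.NoZenoR.Zeno

end
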